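import Mathlib
import HarnessLib
import Summits.Ventures.LatticeQCDFlow.Exactness.WilsonFlowMasks

/-!
# Any masked STAPLE RULE on the gauge field — the active link updated by a function of itself and of its staple links — is a coupling layer, for every group

HONEST FRAMING: exact (Metropolis-corrected) sampling algorithms for lattice gauge theory;
figures of merit are autocorrelation/cost numbers at stated couplings and volumes; no
continuum-physics claim.

Venture `LatticeQCDFlow` (cell pub-lqcd), topic `Exactness`; FANOUT row 14 (`eng-flowhmc`, engine
`latflow.fthmc`, family B).  NEW WORK of the cell; nothing is cited as a fact; no number.  The
group-agnostic corollary of `WilsonFlowMasks` that the engine's `SU(N)` members need (their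
analytic half — per-link bijectivity and the Haar Jacobian of `U ↦ e^{−ε P(U R)} U` — is not in
the tree; this structural half is): on the torus with a proper colouring `χ`, a full-field update
that replaces every link `(x, μ)` of colour `χ x = b` by ANY function `Ψ` of the base point, of
the link itself and of its `6(d−1)` staple links
`(V(x,ν), V(x+ν̂,μ), V(x+μ̂,ν), V(x−ν̂,μ), V(x−ν̂+μ̂,ν), V(x−ν̂,ν))_{ν ≠ μ}` — the masked stout /
Wilson-flow Euler sub-step `maps.wilson_flow_lo` of the engine is of this form, with
`Ψ = exp(−ε P(U·R(staples))) · U` — IS row 31's `Theory2.coupleFun` of the explicit single-link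
family "frozen links `y`, value `g` on the link, rule applied", and a per-link factor of the same
locality multiplies up to `Theory2.coupleJac`.  So for every group the engine's log-det
bookkeeping (sum of per-link log-Jacobians along the masked schedule) is the right one AS SOON AS
the per-link Jacobian is certified (`Theory2.hasJacobian_coupleFun`); for `U(1)` that certificate
is `U1WilsonFlowLOSubstep`, for `SU(N)` it waits for the Haar volume form.

## Content (any type `G` with a `1`; statements about explicit expressions)

* `stapleLinks_eq_of_frozen_eq` — the staple-link tuple of an active link is a function of the
  frozen links (repackaging of `WilsonFlowMasks.links_eq_of_frozen_eq`).
* **`coupleFun_maskedStapleRule`** — masked staple rules are coupling layers.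
* **`coupleJac_maskedStapleFactor`** — their per-link factors multiply to `Theory2.coupleJac`.

NOT here: any analytic property of `Ψ` (bijectivity, Jacobian); which rule is a good map.
-/

namespace Summit.Ventures.LatticeQCDFlow.Exactness

open Literature.MathematicalPhysics.QuantumFieldTheory Summit.Ventures.LatticeQCDFlow.Theory2

variable {d L : ℕ} {G X : Type*}

/-- **The staple-link tuple of an active link is frozen.**  Proper colouring `χ`, active class =
direction `μ`, base colour `b`; if `V` and `W` agree off the active class then for an active base
point `x` the tuples `(V(x,ν), V(x+ν̂,μ), V(x+μ̂,ν), V(x−ν̂,μ), V(x−ν̂+μ̂,ν), V(x−ν̂,ν))_{ν ≠ μ}`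
computed from `V` and from `W` coincide. -/
theorem stapleLinks_eq_of_frozen_eq (χ : Site d L → X)
    (hχ : ∀ (x : Site d L) (i : Fin d), χ (x.shift i) ≠ χ x) {μ : Fin d} {b : X}
    {V W : GaugeConfig d L G} (hVW : ∀ e : Edge d L, ¬(e.2 = μ ∧ χ e.1 = b) → V e = W e)
    {x : Site d L} (hx : χ x = b) :
    (fun ν : {ν : Fin d // ν ≠ μ} =>
        (V (x, ν.1), V (x.shift ν.1, μ), V (x.shift μ, ν.1), V (x - Pi.single ν.1 1, μ),
          V ((x - Pi.single ν.1 1).shift μ, ν.1), V (x - Pi.single ν.1 1, ν.1))) =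
      fun ν : {ν : Fin d // ν ≠ μ} =>
        (W (x, ν.1), W (x.shift ν.1, μ), W (x.shift μ, ν.1), W (x - Pi.single ν.1 1, μ),
          W ((x - Pi.single ν.1 1).shift μ, ν.1), W (x - Pi.single ν.1 1, ν.1)) := by
  funext ν
  obtain ⟨h1, h2, h3, h4, h5, h6⟩ := links_eq_of_frozen_eq χ hχ hVW hx ν.2
  rw [h1, h2, h3, h4, h5, h6]

variable [DecidableEq X] [One G]

/-- **Masked staple rules are coupling layers (any group).**  If the full-field rule `u` updates
the active link `(x, μ)`, `χ x = b`, by a function `Ψ x` of the link itself and of its staple-link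
tuple, then the masked update `V ↦ (e ↦ if active e then u V e else V e)` is `Theory2.coupleFun`
of the explicit single-link family "freeze `y`, put `g` on the link (anything on the other active
links), apply `u`". -/
theorem coupleFun_maskedStapleRule (χ : Site d L → X)
    (hχ : ∀ (x : Site d L) (i : Fin d), χ (x.shift i) ≠ χ x) (μ : Fin d) (b : X)
    (Ψ : Site d L → G → ({ν : Fin d // ν ≠ μ} → G × G × G × G × G × G) → G)
    (u : GaugeConfig d L G → Edge d L → G)
    (hu : ∀ (V : GaugeConfig d L G) (x : Site d L), χ x = b →
      u V (x, μ) = Ψ x (V (x, μ)) fun ν : {ν : Fin d // ν ≠ μ} =>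
        (V (x, ν.1), V (x.shift ν.1, μ), V (x.shift μ, ν.1), V (x - Pi.single ν.1 1, μ),
          V ((x - Pi.single ν.1 1).shift μ, ν.1), V (x - Pi.single ν.1 1, ν.1)))
    (V : GaugeConfig d L G) :
    coupleFun (fun e : Edge d L => e.2 = μ ∧ χ e.1 = b) (fun a y g =>
        u (fun j : Edge d L => if h : j.2 = μ ∧ χ j.1 = b then (if j = a.1 then g else 1)
          else y ⟨j, h⟩) a.1) V =
      fun e => if e.2 = μ ∧ χ e.1 = b then u V e else V e := by
  refine coupleFun_maskedUpdate (p := fun e : Edge d L => e.2 = μ ∧ χ e.1 = b) u ?_ V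
  rintro V' W' ⟨x, μ'⟩ ⟨rfl, hx⟩ ha hVW
  rw [hu V' x hx, hu W' x hx, ha, stapleLinks_eq_of_frozen_eq χ hχ hVW hx]

/-- **Per-link factors of the same locality multiply to the coupling-layer Jacobian.**  If
`c V (x, μ)` is a function of the link and of its staple-link tuple, then the coupling-layer
Jacobian of the family "freeze, put `g`, evaluate `c`" is `∏_{active e} c V e` — the engine's
running sum of per-link log-dets along a masked sub-step, for every group. -/
theorem coupleJac_maskedStapleFactor [NeZero L] (χ : Site d L → X)
    (hχ : ∀ (x : Site d L) (i : Fin d), χ (x.shift i) ≠ χ x) (μ : Fin d) (b : X)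
    (Γ : Site d L → G → ({ν : Fin d // ν ≠ μ} → G × G × G × G × G × G) → ℝ)
    (c : GaugeConfig d L G → Edge d L → ℝ)
    (hc : ∀ (V : GaugeConfig d L G) (x : Site d L), χ x = b →
      c V (x, μ) = Γ x (V (x, μ)) fun ν : {ν : Fin d // ν ≠ μ} =>
        (V (x, ν.1), V (x.shift ν.1, μ), V (x.shift μ, ν.1), V (x - Pi.single ν.1 1, μ),
          V ((x - Pi.single ν.1 1).shift μ, ν.1), V (x - Pi.single ν.1 1, ν.1)))
    (V : GaugeConfig d L G) :
    coupleJac (fun e : Edge d L => e.2 = μ ∧ χ e.1 = b) (fun a y g =>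
        c (fun j : Edge d L => if h : j.2 = μ ∧ χ j.1 = b then (if j = a.1 then g else 1)
          else y ⟨j, h⟩) a.1) V =
      ∏ a : {e : Edge d L // e.2 = μ ∧ χ e.1 = b}, c V a.1 := by
  refine coupleJac_maskedUpdate (p := fun e : Edge d L => e.2 = μ ∧ χ e.1 = b) c ?_ V
  rintro V' W' ⟨x, μ'⟩ ⟨rfl, hx⟩ ha hVW
  rw [hc V' x hx, hc W' x hx, ha, stapleLinks_eq_of_frozen_eq χ hχ hVW hx]

end Summit.Ventures.LatticeQCDFlow.Exactness
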